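import Summits.BirchSwinnertonDyer.Rank1Residual.X11b.Three.UpperHalfLocalMult
import Summits.BirchSwinnertonDyer.Rank1Residual.X2.TwistKodaira
import Literature.NumberTheory.EllipticCurves.Rank1Residual.ClassX1KellerYinTypeA
import HarnessLib

/-!
# Class X11b at `p = 3` (team N8/O2, cell `b2b-bsdres`): the Shimura links' Tamagawa bookkeeping at an ODD prime `p`, part 2 — good and split primes, the numeric Tamagawa condition (sub-target T-O2-T2B@3)

HONEST FRAMING (verbatim, cell `b2b-bsdres`, run/shared/lean/b2b/bsd-rank1-residual/): the goal of
the cell is to DELETE the COMBINATION-SHAPED residual classes for ALL analytic-rank `≤ 1` curves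
over `ℚ` — "full BSD formula for every rank `≤ 1` curve in class `C`" assembled STRICTLY from
published theorems — so that the rank-`≤ 1` remainder becomes exactly the CONSTRUCTION-SHAPED
classes, which are TYPED (missing-input Props), NOT attempted; this is not "finishing BSD".
Research route for class X11b at `p = 3`; no claim beyond the stated class and sub-population;
nothing booked; X11 ∧ `r = 1` at `p = 3` stays CONSTRUCTION-SHAPED (REFEREE R6.2). THEOREMS ONLY
(no definition, no named fact, no `sorry`); elementary local arithmetic, no announced result involved.

## What this file does

Continuation of `UpperHalfLocalMult.lean` (the multiplicative primes). At `p = 3` the remaining two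
`p ≥ 5` local lemmas of multr1-p2's Shimura road fail as stated ("`c ≤ 4 < p`"); the finer facts are:

* a prime `ℓ ∣ d_K` of good reduction of `E`, `d_K` ODD: `E^{d_K}` is of Kodaira type `I₀*` at
  `ℓ ≥ 5`, `c_ℓ ∈ {1, 2, 4}` (Tate's algorithm Step 6; the eisenstein-p2 sub-cell's tree theorem
  `X2.padicValNat_localTamagawaNumber_twist_of_dvd`), and good reduction is preserved at `ℓ ∤ d_K`
  (`X2.localTamagawaNumber_twist_of_not_dvd`, `d_K ≡ 1 mod 4`) — a RAMIFIED `2` (`4 ∣ d_K`, `E` good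
  at `2`) is not covered by a tree theorem, hence the standing hypothesis `d_K` odd;
* an ADDITIVE prime `ℓ` of `E` with `p ∣ c_ℓ(E)` (at `p = 3`: Kodaira type IV or IV*, `c_ℓ = 3`;
  impossible for `p ≥ 5`) is NOT absorbed by the `N⁻`-device of JSW §7.4.2 (only multiplicative
  primes can be put into `N⁻`): it is carried as the explicit hypothesis (β) "`p ∤ c_ℓ(E)` at every
  additive `ℓ`" — the complementary sub-atom (T2γ)@3 of (T2′)@3 has no printed road and stays typed.

Contents (every `p ≠ 2`; `W/ℚ` globally minimal, `Wd = Cd • W^{(d_K)}` globally minimal):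
* `padicValNat_localTamagawaNumber_add_twist_eq_zero_of_good_odd` — a good prime of `E`, `d_K` odd,
  `p ∤ d_K`: contribution `0`;
* `padicValNat_localTamagawaNumber_add_twist_eq_zero_of_isSquare_odd` — a bad prime split in `K`,
  très ramifié if split multiplicative, with (β): contribution `0`;
* `padicValNat_tamagawaProduct_add_twist_le_of_inertSet_odd` — the numeric Tamagawa condition
  `ord_p ∏c(E) + ord_p ∏c(E^{d_K}) ≤ Σ_{ℓ∈S} ord_p(ord_ℓ Δ_min(E))` for the field of JSW §7.4.2 with
  `d_K` ODD, at every odd `p` (multr1-p2's `padicValNat_tamagawaProduct_add_twist_le_of_inertSet'`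
  has `5 ≤ p`).

The class-level consequences at `p = 3` are in `X11b/Three/UpperHalfShimura.lean`. CONDITIONAL
theorems downstream; nothing booked; labels unchanged.

References: [SilvermanATAEC1994] Cor. IV.9.2 (b),(d) (PDF p. 340), IV.9.4 Steps 2 and 6, Table 4.1;
[SilvermanAEC2009] VII.5 Prop. 5.1, VII.6 Ex. 7.6; [JetchevSkinnerWan2017] §7.3.1 (eq:tamK),
§7.4.2 (p. 31).
-/

noncomputable section

open scoped Classical

open WeierstrassCurve NumberField IsDedekindDomain Literature.NumberTheory.EllipticCurves
  Rat.HeightOneSpectrum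
  Literature.NumberTheory.EllipticCurves.Rank1Residual
  Literature.NumberTheory.EllipticCurves.Rank1Residual.Typed
  Literature.NumberTheory.EllipticCurves.ModularForms
  Literature.NumberTheory.QuadraticFields

namespace Summit.BirchSwinnertonDyer.Rank1Residual.X11b.Three

/-! ### The good primes (`d_K` odd) and the split bad primes -/

section Split

variable (W : WeierstrassCurve ℚ) [W.IsElliptic] [W.IsGloballyMinimal]
  (K : Type) [Field K] [NumberField K]
  {Wd : WeierstrassCurve ℚ} [Wd.IsElliptic] [Wd.IsGloballyMinimal] (Cd : VariableChange ℚ)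
  (hWd : Cd • W.quadraticTwist (NumberField.discr K : ℚ) = Wd)
  (ℓ : ℕ) [Fact ℓ.Prime]

include hWd

/-- **At a prime of good reduction of `E`, `p ∤ c_ℓ(E) c_ℓ(E^{d_K})` for every ODD `p ∤ d_K`, when
`d_K` is ODD** (`K` imaginary quadratic). `c_ℓ(E) = 1`; for `E^{d_K}`: if `ℓ ∣ d_K` then `ℓ` is odd
(`d_K` odd), `ℓ ∥ d_K` (`d_K ≡ 1 mod 4` is squarefree), and either `ℓ ≥ 5` — Kodaira type `I₀*`,
`c_ℓ ∈ {1, 2, 4}` (Tate's algorithm Step 6; the eisenstein-p2 sub-cell's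
`X2.padicValNat_localTamagawaNumber_twist_of_dvd`) — or `ℓ = 3`, whence `p ≠ 3` (`p ∤ d_K`), `p ≥ 5`
and `c_ℓ ≤ 4 < p` (multr1-p2's `padicValNat_localTamagawaNumber_add_twist_eq_zero_of_good`); if
`ℓ ∤ d_K` the twist is unramified at `ℓ` (`d_K = 4k + 1`), `E^{d_K}` is good at `ℓ`, `c_ℓ = 1`
(`X2.localTamagawaNumber_twist_of_not_dvd`). For `p ≥ 5` the statement holds without the parity
hypothesis (multr1-p2); the content is `p = 3`, where a ramified `2` (`4 ∣ d_K`, `E` good at `2`) is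
NOT covered by a tree theorem — hence `d_K` odd. [cite: SilvermanATAEC1994, IV.9.4 Step 6 (PDF p. 345) and Table 4.1]
[cite: JetchevSkinnerWan2017, §7.4.1 (eq:tamK)] [cite: SilvermanAEC2009, VII.5 Prop. 5.1(a)] -/
theorem padicValNat_localTamagawaNumber_add_twist_eq_zero_of_good_odd (p : ℕ) [Fact p.Prime]
    (hp2 : p ≠ 2) (hK : IsImaginaryQuadratic K) (hodd : Odd (NumberField.discr K))
    (hpd : ¬ (p : ℤ) ∣ NumberField.discr K) (hgood : W.HasGoodReductionAtPrime ℓ) :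
    padicValNat p ((W.baseChange ℚ_[ℓ]).localTamagawaNumber ℤ_[ℓ]) +
      padicValNat p ((Wd.baseChange ℚ_[ℓ]).localTamagawaNumber ℤ_[ℓ]) = 0 := by
  by_cases hp5 : 5 ≤ p
  · exact padicValNat_localTamagawaNumber_add_twist_eq_zero_of_good W K Cd hWd ℓ p hp5 hgood
  have hpP : p.Prime := Fact.out
  have hℓP : ℓ.Prime := Fact.out
  have hp3 : p = 3 := by
    have h2 := hpP.two_le
    interval_cases p
    · exact absurd rfl hp2
    · rfl
    · exact absurd hpP (by decide)
  set d : ℤ := NumberField.discr K with hd_def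
  have hdZ : d ≠ 0 := NumberField.discr_ne_zero K
  -- `c_ℓ(W) = 1`
  have hcW : (W.baseChange ℚ_[ℓ]).localTamagawaNumber ℤ_[ℓ] = 1 := by
    haveI : ((W.baseChange ℚ_[ℓ]).minimal ℤ_[ℓ]).HasGoodReduction ℤ_[ℓ] := hgood
    exact localTamagawaNumber_eq_one_of_hasGoodReduction_holds ℤ_[ℓ] _
  rw [hcW, padicValNat_one_right, zero_add]
  by_cases hℓd : (ℓ : ℤ) ∣ d
  · -- `ℓ ∣ d_K`: `ℓ ≥ 5`, `ℓ ∥ d_K`, Kodaira type `I₀*`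
    have hℓ2 : ℓ ≠ 2 := by
      rintro rfl
      obtain ⟨m, hm⟩ := hodd
      omega
    have hℓ3 : ℓ ≠ 3 := by
      rintro rfl
      exact hpd (by rw [hp3]; exact hℓd)
    have hℓ5 : 5 ≤ ℓ := by
      have h2 := hℓP.two_le
      by_contra hlt
      interval_cases ℓ
      · exact hℓ2 rfl
      · exact hℓ3 rfl
      · exact absurd hℓP (by decide)
    have hsq : ¬ (ℓ : ℤ) ^ 2 ∣ d := by
      intro h
      have hsf := squarefree_discr_of_odd hK hodd
      have hunit := hsf (ℓ : ℤ) (by rw [← sq]; exact h)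
      rw [Int.isUnit_iff_natAbs_eq, Int.natAbs_natCast] at hunit
      exact hℓP.one_lt.ne' hunit
    exact X2.padicValNat_localTamagawaNumber_twist_of_dvd W p hp2 ℓ hℓ5 hdZ hℓd hsq hgood Cd hWd
  · -- `ℓ ∤ N d_K`: unramified twist, good reduction preserved, `c_ℓ(Wd) = 1`
    have h4 : d = 4 * (d / 4) + 1 := by
      rcases Quadratic.isFundamentalDiscriminant_discr (K := K) hK.1 with ⟨h1, -, -⟩ | ⟨h4, -, -⟩
      · omega
      · exfalso
        obtain ⟨k, hk⟩ := h4
        obtain ⟨m, hm⟩ := hodd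
        omega
    rw [X2.localTamagawaNumber_twist_of_not_dvd W ℓ h4 hℓd hgood Cd hWd, padicValNat_one_right]

omit [Wd.IsElliptic] [Wd.IsGloballyMinimal] in
/-- **At a bad prime split in `K`, `p ∤ c_ℓ(E) c_ℓ(E^{d_K})` for every ODD `p`**, provided `ℓ` is not
split multiplicative with `p ∣ ord_ℓ Δ_min` (`hFC`) and — hypothesis (β), vacuous for `p ≥ 5` — `p`
does not divide the Tamagawa number of `E` at `ℓ` if `ℓ` is ADDITIVE (at `p = 3`: `ℓ` is not of
Kodaira type IV / IV* with rational components). `d_K ∈ ℚ_ℓ^{×2}`, so `E^{d_K} ≅ E` over `ℚ_ℓ` and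
`c_ℓ(E^{d_K}) = c_ℓ(E)` (`localTamagawaNumber_twist_eq_of_isSquare`, Silverman VII.6 Ex. 7.6); at a
multiplicative `ℓ`, `p ∤ c_ℓ(E)` by `not_dvd_localTamagawaNumber_of_mult` (non-split: `c ∈ {1,2}`;
split: `c = ord_ℓ Δ_min`, `hFC`). Odd-prime companion of multr1-p2's
`padicValNat_localTamagawaNumber_add_twist_eq_zero_of_isSquare` (`p ≥ 5`).
[cite: SilvermanATAEC1994, Cor. IV.9.2(d) with (b) (PDF p. 340) and IV.9.4 Step 2]
[cite: SilvermanAEC2009, VII.6 Ex. 7.6 and X.5 Cor. 5.4] -/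
theorem padicValNat_localTamagawaNumber_add_twist_eq_zero_of_isSquare_odd (p : ℕ) [Fact p.Prime]
    (hp2 : p ≠ 2) (hsq : IsSquare (algebraMap ℚ ℚ_[ℓ] (NumberField.discr K : ℚ)))
    (hFC : W.HasSplitMultiplicativeReductionAtPrime ℓ → ¬ p ∣ padicValInt ℓ W.minimalDiscriminantInt)
    (hβ : ¬ Mult W ℓ → ¬ p ∣ (W.baseChange ℚ_[ℓ]).localTamagawaNumber ℤ_[ℓ]) :
    padicValNat p ((W.baseChange ℚ_[ℓ]).localTamagawaNumber ℤ_[ℓ]) +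
      padicValNat p ((Wd.baseChange ℚ_[ℓ]).localTamagawaNumber ℤ_[ℓ]) = 0 := by
  have hp3 : 3 ≤ p := by
    have := (Fact.out : p.Prime).two_le
    omega
  haveI : (W.baseChange ℚ_[ℓ]).IsElliptic := inferInstanceAs (W.map (algebraMap ℚ ℚ_[ℓ])).IsElliptic
  rw [localTamagawaNumber_twist_eq_of_isSquare W K Cd hWd ℓ hsq, ← two_mul, mul_eq_zero]
  refine Or.inr (padicValNat.eq_zero_of_not_dvd ?_)
  by_cases hm : Mult W ℓ
  · refine not_dvd_localTamagawaNumber_of_mult W p ℓ hp3 hm ?_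
    by_cases hs : W.HasSplitMultiplicativeReductionAtPrime ℓ
    · exact Or.inr (hFC hs)
    · exact Or.inl hs
  · exact hβ hm

end Split

/-! ### The field of JSW §7.4.2 with `d_K` odd: the numeric Tamagawa condition at every odd `p` -/

/-- `ord_p` of a finite product of non-zero naturals is the sum of the `ord_p`. [folklore] -/
private theorem padicValNat_finset_prod₃ (p : ℕ) [Fact p.Prime] {ι : Type*} (s : Finset ι)
    (f : ι → ℕ) (hf : ∀ i ∈ s, f i ≠ 0) :
    padicValNat p (∏ i ∈ s, f i) = ∑ i ∈ s, padicValNat p (f i) := by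
  induction s using Finset.induction_on with
  | empty => simp
  | insert a s ha ih =>
    rw [Finset.prod_insert ha, Finset.sum_insert ha,
      padicValNat.mul (hf a (Finset.mem_insert_self a s))
        (Finset.prod_ne_zero_iff.mpr fun i hi => hf i (Finset.mem_insert_of_mem hi)),
      ih fun i hi => hf i (Finset.mem_insert_of_mem hi)]

/-- **The numeric Tamagawa condition for the field of JSW §7.4.2 at every ODD prime `p`
(`p = 3` included), `d_K` odd.** `W/ℚ` globally minimal, `K` imaginary quadratic with `d_K` ODD and
`p ∤ d_K`, `Wd` a globally minimal model of `E^{d_K}`, `S` a finite set of primes — multiplicative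
for `E` and inert in `K` (`(d_K/ℓ) = −1` at odd `ℓ`, `d_K ≡ 5 mod 8` at `ℓ = 2`) —, every bad prime
outside `S` split in `K` (`d_K ∈ ℚ_ℓ^{×2}`), every split multiplicative prime outside `S` très
ramifié (`p ∤ ord_ℓ Δ_min`), and (β) `p ∤ c_ℓ(E)` at every ADDITIVE prime `ℓ` of `E`. Then
`ord_p ∏c(E) + ord_p ∏c(E^{d_K}) ≤ Σ_{ℓ∈S} ord_p(ord_ℓ Δ_min(E))` — prime by prime: the inert primes
contribute `≤ ord_p(ord_ℓ Δ_min)` (`…_add_twist_le_of_inert_odd`, `…_of_inert_two_odd`), the split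
bad primes and the good primes `0` (`…_eq_zero_of_isSquare_odd`, `…_eq_zero_of_good_odd`). This is
multr1-p2's `padicValNat_tamagawaProduct_add_twist_le_of_inertSet'` with `5 ≤ p` replaced by
`p ≠ 2` + `d_K` odd + (β) (both automatic consequences of `5 ≤ p` there: `c ≤ 4 < p`).
[cite: JetchevSkinnerWan2017, §7.4.2 (p. 31) and §7.3.1 (eq:tamK)]
[cite: SilvermanATAEC1994, Cor. IV.9.2(d) with (b) (PDF p. 340), IV.9.4 Steps 2 and 6] -/
theorem padicValNat_tamagawaProduct_add_twist_le_of_inertSet_odd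
    (W : WeierstrassCurve ℚ) [W.IsElliptic] [W.IsGloballyMinimal] (p : ℕ) [Fact p.Prime]
    (hp2 : p ≠ 2) (K : Type) [Field K] [NumberField K] (hK : IsImaginaryQuadratic K)
    (hodd : Odd (NumberField.discr K)) (hpd : ¬ (p : ℤ) ∣ NumberField.discr K)
    {Wd : WeierstrassCurve ℚ} [Wd.IsElliptic] [Wd.IsGloballyMinimal] (Cd : VariableChange ℚ)
    (hWd : Cd • W.quadraticTwist (NumberField.discr K : ℚ) = Wd)
    (S : Finset ℕ)
    (hS : ∀ ℓ ∈ S, ∃ _ : Fact ℓ.Prime, Mult W ℓ ∧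
      ((ℓ ≠ 2 ∧ jacobiSym (NumberField.discr K) ℓ = -1) ∨ (ℓ = 2 ∧ NumberField.discr K % 8 = 5)))
    (hsplit : ∀ (ℓ : ℕ) [Fact ℓ.Prime], ¬ W.HasGoodReductionAtPrime ℓ → ℓ ∉ S →
      IsSquare (algebraMap ℚ ℚ_[ℓ] (NumberField.discr K : ℚ)))
    (hFC : ∀ (ℓ : ℕ) [Fact ℓ.Prime], ℓ ∉ S → W.HasSplitMultiplicativeReductionAtPrime ℓ →
      ¬ p ∣ padicValInt ℓ W.minimalDiscriminantInt)
    (hβ : ∀ (ℓ : ℕ) [Fact ℓ.Prime], ¬ W.HasGoodReductionAtPrime ℓ → ¬ Mult W ℓ →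
      ¬ p ∣ (W.baseChange ℚ_[ℓ]).localTamagawaNumber ℤ_[ℓ]) :
    padicValNat p W.tamagawaProduct + padicValNat p Wd.tamagawaProduct ≤
      ∑ ℓ ∈ S, padicValNat p (padicValInt ℓ W.minimalDiscriminantInt) := by
  have hp : p.Prime := Fact.out
  have hfW : (W.badPlaces ℤ).Finite := W.finite_badPlaces_holds ℤ
  have hfWd : (Wd.badPlaces ℤ).Finite := Wd.finite_badPlaces_holds ℤ
  set s : Finset (HeightOneSpectrum ℤ) := hfW.toFinset ∪ hfWd.toFinset with hs
  have hsW : ∀ v, ¬ W.HasGoodReductionAt v → v ∈ s := fun v hv ↦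
    Finset.mem_union_left _ (by rw [Set.Finite.mem_toFinset, mem_badPlaces_iff]; exact hv)
  have hsWd : ∀ v, ¬ Wd.HasGoodReductionAt v → v ∈ s := fun v hv ↦
    Finset.mem_union_right _ (by rw [Set.Finite.mem_toFinset, mem_badPlaces_iff]; exact hv)
  set f : HeightOneSpectrum ℤ → ℕ := fun v ↦
    haveI := Fact.mk (primesEquiv v).2
    padicValNat p ((W.baseChange ℚ_[primesEquiv v]).localTamagawaNumber ℤ_[primesEquiv v]) +
      padicValNat p ((Wd.baseChange ℚ_[primesEquiv v]).localTamagawaNumber ℤ_[primesEquiv v]) with hf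
  set g : ℕ → ℕ := fun ℓ ↦ padicValNat p (padicValInt ℓ W.minimalDiscriminantInt) with hg
  have hterm : ∀ v : HeightOneSpectrum ℤ,
      f v ≤ if (primesEquiv v : ℕ) ∈ S then g (primesEquiv v : ℕ) else 0 := by
    intro v
    haveI := Fact.mk (primesEquiv v).2
    have key : ∀ (q : ℕ) (hq : Fact q.Prime), (primesEquiv v : ℕ) = q →
        padicValNat p (@WeierstrassCurve.localTamagawaNumber ℤ_[q] _ _ _ ℚ_[q] _ _ _ (W.baseChange ℚ_[q])) +
          padicValNat p (@WeierstrassCurve.localTamagawaNumber ℤ_[q] _ _ _ ℚ_[q] _ _ _ (Wd.baseChange ℚ_[q])) ≤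
          if q ∈ S then g q else 0 := by
      rintro q hq hvq
      by_cases hqS : q ∈ S
      · obtain ⟨_, hmult, hcase⟩ := hS q hqS
        rw [if_pos hqS, hg]
        rcases hcase with ⟨hq2, hJ⟩ | ⟨rfl, h8⟩
        · exact padicValNat_localTamagawaNumber_add_twist_le_of_inert_odd W K Cd hWd q hq2 hJ p hp2
            hmult
        · exact padicValNat_localTamagawaNumber_add_twist_le_of_inert_two_odd W K Cd hWd h8 p hp2 hmult
      · rw [if_neg hqS, Nat.le_zero]
        by_cases hgood : W.HasGoodReductionAtPrime q
        · exact padicValNat_localTamagawaNumber_add_twist_eq_zero_of_good_odd W K Cd hWd q p hp2 hK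
            hodd hpd hgood
        · exact padicValNat_localTamagawaNumber_add_twist_eq_zero_of_isSquare_odd W K Cd hWd q p hp2
            (hsplit q hgood hqS) (hFC q hqS) (hβ q hgood)
    exact key _ _ rfl
  rw [tamagawaProduct_eq_prod W s hsW, tamagawaProduct_eq_prod Wd s hsWd,
    padicValNat_finset_prod₃ p s _ fun v _ ↦ ?_, padicValNat_finset_prod₃ p s _ fun v _ ↦ ?_,
    ← Finset.sum_add_distrib]
  · calc ∑ v ∈ s, f v
        ≤ ∑ v ∈ s, (if (primesEquiv v : ℕ) ∈ S then g (primesEquiv v : ℕ) else 0) :=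
          Finset.sum_le_sum fun v _ ↦ hterm v
      _ = ∑ ℓ ∈ s.image (fun v ↦ (primesEquiv v : ℕ)), (if ℓ ∈ S then g ℓ else 0) := by
          rw [Finset.sum_image]
          intro v _ w _ h
          exact primesEquiv.injective (Subtype.ext h)
      _ ≤ ∑ ℓ ∈ S, g ℓ := by
          rw [← Finset.sum_filter]
          refine Finset.sum_le_sum_of_subset_of_nonneg (fun ℓ hℓ ↦ (Finset.mem_filter.mp hℓ).2)
            fun _ _ _ ↦ Nat.zero_le _
  · haveI := Fact.mk (primesEquiv v).2
    haveI : (W.baseChange ℚ_[primesEquiv v]).IsElliptic :=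
      inferInstanceAs (W.map (algebraMap ℚ ℚ_[primesEquiv v])).IsElliptic
    exact localTamagawaNumber_padic_ne_zero_holds (primesEquiv v) _
  · haveI := Fact.mk (primesEquiv v).2
    haveI : (Wd.baseChange ℚ_[primesEquiv v]).IsElliptic :=
      inferInstanceAs (Wd.map (algebraMap ℚ ℚ_[primesEquiv v])).IsElliptic
    exact localTamagawaNumber_padic_ne_zero_holds (primesEquiv v) _

end Summit.BirchSwinnertonDyer.Rank1Residual.X11b.Three

end
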